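/-
Copyright: the b2b-balaban cell (near-miss cell 7), T⁴-continuum fan-out; row NE7b ROUND-2 swarm, seat
t4-ne7b-formalise-leaf-10 (gen 6) — supplier piece «T3b-READ» for the S6g′ INSTANCE's T3b (owner's rulings
R-OWNER-22-23 and R-OWNER-23-3∕-4∕-5; T3b holder leaf-05 g4), part 2 of 3: THE ROOT VALUE, THE BIRTHS' READING AND THE
JOIN RECURSION OF THE MEMBER'S PLACEMENT (journal OFFER l.13598).  A supplier module consumed BY NAME; not a claim of T3b.
Released under the licence of the surrounding project.
-/
import Summits.QuantumFields.BalabanUV.T4Continuum.Support.HistoryMemberPlacement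
import Summits.QuantumFields.BalabanUV.T4Continuum.Support.HistorySiblingEntropySortPhys
import Summits.QuantumFields.BalabanUV.T4Continuum.Support.HistoryJoinsRearrange

/-!
# The member's placement reading, part 2: its root value, its births' reading and its join recursion

Summits-side support leaf of the T⁴-continuum cell (rung (B)+1 on a FINITE torus only; NOT infinite volume, NOT the
mass gap, NOT the Clay statement; NOT a proof of the spine estimate NE7b).  Row NE7b, route «COUNT», row S6g′
INSTANCE, piece T3b (holder leaf-05 g4) — the member side, continued from part 1 `HistoryMemberPlacement` (`readAt`,
`placed`, `naddr`, `subAt`, `junk_placed`, `rel_placed_subAt`, `cfg_placed_join`) with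
leaf-02 g6's letters `bread`∕`AllJoins` (`HistoryJoinsRearrange`) and leaf-10 gen 5's sorted-twin agreement
(`HistorySiblingEntropySortPhys`: `PGen.pbirths`) and
Mathlib's multiset disjointness.  [folklore] structural recursion and rewriting; nothing is quoted from print, nothing
printed is asserted, no `[cite:]` tag, no definition.

WHAT (`hD : ∀ a ∈ baddr g.toGen, a.length ≤ D` where marked).
* §3 the root value: `readAt_rootAddr`, **`evalA_placed_rootAddr`** (hD): `v (Gen.root g.toGen) g.rootCell`.
* §4 **`bread_placed`** (hD): `bread c₀ g.toGen (placed c₀ v g) = g.pbirths.map (label, v label payload)` — the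
  recommended `phys` of R-OWNER-23-5 (2) IS the births' reading of the member's placement; `bread_cfg_placed_join`
  (the parts of a join's top join read the part sub-members' births: the letters of `PhysTop`'s second clause);
  `allJoins_placed_birth`, `allJoins_placed_renew_iff`, **`allJoins_placed_join_iff`** (hD; a local predicate at every
  join of a join's placement ⇔ at the top AND at every join of each part sub-member's OWN placement — the recursion the
  T3b holder runs with `L := PhysTop c₀ st zone`, strong induction on `gsize` as in `exists_rearranged_cadm`),
  **`allJoins_placed_iff`** (hD; ⇔ the predicate at the sub-member of every join root).
* §4c under a DUPLICATE-FREE value multiset (the displayed side condition `hdis` of R-OWNER-23-6, F-leaf05g4-1):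
  `sum_pbirths_clusterParts` (the member's births are the sum of its cluster parts' sub-members' births),
  `pairwise_disjoint_of_nodup_sum`, `pbirths_ne_zero`, **`bread_cfg_placed_ne`** — two DISTINCT parts of a join's top
  join read DIFFERENT births (the member side of `PhysTop`'s second clause).
Part 3 (`HistoryMemberPlacementParts`): chains of joins and pedigrees (the sorted twin's member, its parts = the listing).

HONEST SCOPE.  As part 1: the member side only; `PhysTop` from `Realises`, `hzone`, `hρ`, the template factor and the
image count into `koccOf` are T3b's.  Nothing of H3∕(B)∕BetaPertH touched; `BirthShapeNodup`∕`resum`∕`hmult` NOT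
retired; NE7b NOT proved; spine 0∕9.  HONEST DEPENDENCY (cell): continuum YM on T⁴ ⇐ BetaPertH ∧ nine spine
estimates (0/9 proved); BetaPertH ⇐ (D1) ∧ (D4) ∧ CAP+tail; G-an2-4 gates asym, D1 and NE2/3/4.  This file changes
none of it.
-/

open Finset
open Literature.MathematicalPhysics.QuantumFieldTheory.Balaban1983to89
open T4PersistenceDictionary
open Summit.QuantumFields.BalabanUV.T4Continuum.HistoryGen
open Summit.QuantumFields.BalabanUV.T4Continuum.HistoryJoins
open Summit.QuantumFields.BalabanUV.T4Continuum.HistoryJoinsAdm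
open Summit.QuantumFields.BalabanUV.T4Continuum.HistoryJoinsRearrange

noncomputable section

namespace Summit.QuantumFields.BalabanUV.T4Continuum.HistoryAdmissible.PGen

variable {γ ν : Type*} {D : ℕ} (c₀ : ν) (v : PEv → γ → ν)

/-! ## §3 The root value -/

/-- **THE READING AT THE ROOT ADDRESS IS THE ROOT DATUM**: the root label of the flat tree with the member's root
cell. [folklore] -/
theorem readAt_rootAddr : ∀ g : PGen γ, readAt c₀ v g (rootAddr g.toGen) = v (Gen.root g.toGen) g.rootCell
  | birth j d z => rfl
  | renew G h => by
      rw [readAt_renew]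
      exact readAt_rootAddr G
  | join X Y s => by
      simp only [toGen, rootAddr, Gen.root, rootCell, rootStep_toGen]
      split_ifs with h
      · rw [readAt_join_false]; exact readAt_rootAddr X
      · rw [readAt_join_true]; exact readAt_rootAddr Y

/-- **THE ROOT VALUE OF THE MEMBER'S PLACEMENT** (depth: the birth addresses fit the space). [folklore] -/
theorem evalA_placed_rootAddr (g : PGen γ) (hD : ∀ a ∈ baddr g.toGen, a.length ≤ D) :
    evalA c₀ (placed (D := D) c₀ v g) (rootAddr g.toGen) = v (Gen.root g.toGen) g.rootCell := by
  rw [evalA_placed c₀ v g hD, readAt_rootAddr]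

/-! ## §4 With leaf-02 g6's letters: the births' reading and the recursion over the joins -/

/-- **THE BIRTHS' READING OF THE MEMBER'S PLACEMENT IS THE MEMBER'S MULTISET OF PHYSICAL BIRTHS, READ THROUGH THE
VALUE MAP** — R-OWNER-23-5 (2)'s recommended `phys`, read off the placement (depth: the birth addresses fit the
space). [folklore] -/
theorem bread_placed : ∀ (g : PGen γ), (∀ a ∈ baddr g.toGen, a.length ≤ D) →
    bread c₀ g.toGen (placed (D := D) c₀ v g) = g.pbirths.map (fun bz => (bz.1, v bz.1 bz.2))
  | birth j d z, _ => by
      simp only [toGen, bread_born, pbirths_birth, Multiset.map_singleton]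
      rw [evalA_placed_of_le c₀ v _ (by simp), readAt_birth_nil]
  | renew G h, hD => by
      simp only [toGen, bread_renew, pbirths_renew, placed_renew]
      exact bread_placed G (depth_renew_iff.1 hD)
  | join X Y s, hD => by
      simp only [toGen, bread_merge, pbirths_join, Multiset.map_add]
      rw [rel_false_placed_join c₀ v X Y s (depth_left hD), rel_true_placed_join c₀ v X Y s (depth_right hD),
        bread_placed X fun a ha => (Nat.le_succ _).trans (depth_left hD a ha),
        bread_placed Y fun a ha => (Nat.le_succ _).trans (depth_right hD a ha)]

/-- **THE PARTS OF A JOIN'S TOP JOIN READ THE PART SUB-MEMBERS' PHYSICAL BIRTHS** (the letters of `PhysTop`'s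
second clause). [folklore] -/
theorem bread_cfg_placed_join (X Y : PGen γ) (s : ℕ) (hD : ∀ b ∈ baddr (join X Y s).toGen, b.length ≤ D)
    (i : Fin (npart PEv.step (Gen.merge X.toGen Y.toGen ((s, 2, 0) : PEv)))) :
    bread c₀ (part PEv.step _ i).2 (cfg c₀ PEv.step X.toGen Y.toGen ((s, 2, 0) : PEv) (placed (D := D) c₀ v (join X Y s)) i) =
      (subAt (join X Y s) (part PEv.step _ i).1).pbirths.map (fun bz => (bz.1, v bz.1 bz.2)) := by
  rw [cfg_placed_join c₀ v X Y s hD i, ← toGen_subAt_part X Y s i,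
    bread_placed c₀ v _ (depth_subAt_part X Y s hD i)]


/-! ## §4c Duplicate-free value multisets: distinct parts read different births (`PhysTop` clause 2, member side) -/

/-- the physical births of the member are the SUM of its step-`t` cluster parts' sub-members' births [folklore] -/
theorem sum_pbirths_clusterParts (t : ℕ) : ∀ g : PGen γ,
    ((clusterParts PEv.step t g.toGen).map (fun q => (subAt g q.1).pbirths)).sum = g.pbirths
  | birth j d z => by simp [toGen]
  | renew G h => by simp [toGen]
  | join X Y s => by
      by_cases hst : PEv.step ((s, 2, 0) : PEv) = t
      · simp only [toGen]
        rw [clusterParts_merge_of_eq PEv.step hst, List.map_append, List.sum_append, List.map_map, List.map_map,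
          pbirths_join, ← sum_pbirths_clusterParts t X, ← sum_pbirths_clusterParts t Y]
        rfl
      · simp only [toGen]
        rw [clusterParts_merge_of_ne PEv.step hst]
        simp [pbirths]

/-- in a list of multisets with a duplicate-free sum the entries are pairwise disjoint [folklore] -/
theorem pairwise_disjoint_of_nodup_sum {β : Type*} : ∀ L : List (Multiset β), L.sum.Nodup → L.Pairwise Disjoint
  | [], _ => List.Pairwise.nil
  | a :: L, h => by
      rw [List.sum_cons, Multiset.nodup_add] at h
      exact List.pairwise_cons.2
        ⟨fun m hm => h.2.2.mono_right (List.le_sum_of_mem hm), pairwise_disjoint_of_nodup_sum L h.2.1⟩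

/-- a non-empty multiset is not disjoint from itself [folklore] -/
theorem ne_of_disjoint_of_ne_zero {β : Type*} {m n : Multiset β} (h : Disjoint m n) (hm : m ≠ 0) : m ≠ n := by
  rintro rfl
  obtain ⟨a, ha⟩ := Multiset.exists_mem_of_ne_zero hm
  exact Multiset.disjoint_left.1 h ha ha

/-- every member has a physical birth [folklore] -/
theorem pbirths_ne_zero : ∀ g : PGen γ, g.pbirths ≠ 0
  | birth j d z => by simp
  | renew G h => by rw [pbirths_renew]; exact pbirths_ne_zero G
  | join X Y s => by
      rw [pbirths_join]
      exact fun h => pbirths_ne_zero X (le_antisymm (h ▸ Multiset.le_add_right _ _) (Multiset.zero_le _))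

/-- **UNDER A DUPLICATE-FREE VALUE MULTISET, TWO DISTINCT PARTS OF A JOIN'S TOP JOIN READ DIFFERENT BIRTHS** — the
member side of `PhysTop`'s second clause under the displayed side condition `hdis` of R-OWNER-23-6 (the parts' value
multisets are disjoint non-empty sub-multisets of a duplicate-free one). [folklore] -/
theorem bread_cfg_placed_ne {δ : Type*} (w : PEv × ν → δ) (X Y : PGen γ) (s : ℕ)
    (hD : ∀ b ∈ baddr (join X Y s).toGen, b.length ≤ D)
    (hdis : (((join X Y s).pbirths.map fun bz => (bz.1, v bz.1 bz.2)).map w).Nodup)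
    {i j : Fin (npart PEv.step (Gen.merge X.toGen Y.toGen ((s, 2, 0) : PEv)))} (hij : i ≠ j) :
    (bread c₀ (part PEv.step _ i).2 (cfg c₀ PEv.step X.toGen Y.toGen ((s, 2, 0) : PEv) (placed (D := D) c₀ v (join X Y s)) i)).map w ≠
      (bread c₀ (part PEv.step _ j).2 (cfg c₀ PEv.step X.toGen Y.toGen ((s, 2, 0) : PEv) (placed (D := D) c₀ v (join X Y s)) j)).map w := by
  rw [bread_cfg_placed_join c₀ v X Y s hD i, bread_cfg_placed_join c₀ v X Y s hD j, Multiset.map_map, Multiset.map_map]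
  set F : List Bool × Gen PEv → Multiset δ := fun q => (subAt (join X Y s) q.1).pbirths.map (w ∘ fun bz => (bz.1, v bz.1 bz.2))
  have hsum : ((jparts PEv.step (join X Y s).toGen).map F).sum =
      ((join X Y s).pbirths.map fun bz => (bz.1, v bz.1 bz.2)).map w := by
    have e := congrArg (Multiset.map (w ∘ fun bz => (bz.1, v bz.1 bz.2)))
      (sum_pbirths_clusterParts (PEv.step ((s, 2, 0) : PEv)) (join X Y s))
    rw [Multiset.map_map, ← e, ← Multiset.coe_mapAddMonoidHom, map_list_sum, List.map_map]
    rfl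
  have hpw : ((jparts PEv.step (join X Y s).toGen).map F).Pairwise Disjoint :=
    pairwise_disjoint_of_nodup_sum _ (hsum ▸ hdis)
  rw [List.pairwise_map, List.pairwise_iff_getElem] at hpw
  have hne : ∀ q : List Bool × Gen PEv, F q ≠ 0 := fun q => by
    simp only [F, ne_eq, Multiset.map_eq_zero]; exact pbirths_ne_zero _
  change F (part PEv.step _ i) ≠ F (part PEv.step _ j)
  simp only [part]
  rcases lt_or_gt_of_ne (Fin.val_ne_of_ne hij) with h | h
  · exact ne_of_disjoint_of_ne_zero (hpw i.1 j.1 i.2 j.2 h) (hne _)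
  · exact (ne_of_disjoint_of_ne_zero (hpw j.1 i.1 j.2 i.2 h) (hne _)).symm

section AllJoins

variable (L : Gen PEv → (Addr D → ν) → Prop)

/-- a bare birth's placement has no join to check [folklore] -/
theorem allJoins_placed_birth (j d : ℕ) (z : γ) :
    AllJoins c₀ PEv.step L (birth j d z).toGen (placed (D := D) c₀ v (birth j d z)) :=
  allJoins_born c₀ PEv.step L _ _ _

/-- a renewal's placement has the joins of the renewed member's placement [folklore] -/
theorem allJoins_placed_renew_iff (G : PGen γ) (h : ℕ) :
    AllJoins c₀ PEv.step L (renew G h).toGen (placed (D := D) c₀ v (renew G h)) ↔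
      AllJoins c₀ PEv.step L G.toGen (placed (D := D) c₀ v G) := by
  rw [placed_renew]
  exact allJoins_renew_iff c₀ PEv.step L _ _ _ _

/-- **THE RECURSION OVER THE JOINS, ON THE MEMBER**: a local predicate holds at every join of a join's placement iff it
holds at the top AND at every join of each part sub-member's OWN placement (depth: the birth addresses fit the space).
The T3b holder runs this with `L := PhysTop c₀ st zone`. [folklore] -/
theorem allJoins_placed_join_iff (X Y : PGen γ) (s : ℕ) (hD : ∀ b ∈ baddr (join X Y s).toGen, b.length ≤ D) :
    AllJoins c₀ PEv.step L (join X Y s).toGen (placed (D := D) c₀ v (join X Y s)) ↔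
      L (join X Y s).toGen (placed (D := D) c₀ v (join X Y s)) ∧
        ∀ i : Fin (npart PEv.step (Gen.merge X.toGen Y.toGen ((s, 2, 0) : PEv))),
          AllJoins c₀ PEv.step L (subAt (join X Y s) (part PEv.step _ i).1).toGen
            (placed (D := D) c₀ v (subAt (join X Y s) (part PEv.step _ i).1)) := by
  have h := allJoins_merge_iff c₀ PEv.step L X.toGen Y.toGen ((s, 2, 0) : PEv) (placed (D := D) c₀ v (join X Y s))
  simp only [toGen] at h ⊢
  rw [h]
  refine and_congr Iff.rfl (forall_congr' fun i => ?_)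
  rw [cfg_placed_join c₀ v X Y s hD i, toGen_subAt_part X Y s i]

/-- **A LOCAL PREDICATE AT EVERY JOIN OF THE MEMBER'S PLACEMENT ⇔ AT THE SUB-MEMBER OF EVERY JOIN ROOT** (depth: the
birth addresses fit the space). [folklore] -/
theorem allJoins_placed_iff (g : PGen γ) (hD : ∀ b ∈ baddr g.toGen, b.length ≤ D) :
    AllJoins c₀ PEv.step L g.toGen (placed (D := D) c₀ v g) ↔
      ∀ q ∈ croots PEv.step g.toGen, L q.2 (placed (D := D) c₀ v (subAt g q.1)) := by
  refine forall₂_congr fun q hq => ?_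
  rw [rel_placed_subAt c₀ v (mem_naddr_of_mem_croots hq) hD]

end AllJoins

end Summit.QuantumFields.BalabanUV.T4Continuum.HistoryAdmissible.PGen

end
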